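import Summits.ValiantsHypothesis.ValiantsHypothesis.Theorems.SymPencilPerFourPeeledCornerSwap

/-!
# Route `SymPencil` — `2 | 2` inner rank of `per_4`, PEELED case at `≤ 11` squares: the corner,
# given the relations, for a GENERAL `a`-side correction vanishing on `e₂, e₃` (`--supports`
# stmt-ValiantsHypothesis-5674 `SdcSuperquadratic`; (8,8) column, cell (8,8,11); memo
# `NOTE-p6g16-5674-corner-double-swap.md` §3; `NOTE-p8g15-5674-R2-two-pencil.md` §9.6)

`…CornerSwap.false_of_swap_of_relations` (val-lit-p6 g16) assumes the `a`-side correction is the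
PURE swap `u₀(a₀x₁ + a₁x₀)`, but its proof only uses that the correction vanishes on `x = e₂, e₃`.
This file restates the theorem with that weaker hypothesis (`false_of_relations_of_vanishing`,
proof verbatim), so that the GENERALIZED swaps `u₀a₀x₁ + w₀a₁x₀` — the possible second frameless
class of the coverage programme (memo `NOTE-p8g15…` §9.6) — are covered: with the four relations
`ν₂₀ = ν₀₂, ν₂₁ = ν₁₂, ν₃₁ = ν₁₃, ν₃₂ = ν₂₃` the family does not exist (`β = ⟨ν₀₂,ν₁₃⟩ = −β`, a
totally isotropic `6`-space, twelve independent vectors, `…CornerSwap.false_of_twelve_vectors`).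

Honest framing: one half of the same-pair generalized-swap corner (the relations are hypotheses
here; they are derived off the locus `u₀u₁ + w₀w₁ = 0` in the sequel); no cell closes;
`28 ≤ sdc(per_4) ≤ 29` of record, the crux `SdcSuperquadratic` and `VP ≠ VNP` untouched.  Gram
bookkeeping after val-lit-p8 g15's `…TwoPencilDesign`.  No definitions, no named facts. [folklore]
-/

noncomputable section

-- single-conjunct layout: Sub = Summit, duplicated namespace component intended
set_option linter.dupNamespace false

namespace Summit.ValiantsHypothesis.ValiantsHypothesis.Theorems.SymPencilPerFourPeeledCornerGenSwapRelations

open Matrix Finset Module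
open Summit.ValiantsHypothesis.ValiantsHypothesis.Theorems.SymPencilPerFourInnerRankRows
open Summit.ValiantsHypothesis.ValiantsHypothesis.Theorems.SymPencilPerFourInnerRankTenPairs
open Summit.ValiantsHypothesis.ValiantsHypothesis.Theorems.SymPencilPerFourInnerRankScalarBlock
open Summit.ValiantsHypothesis.ValiantsHypothesis.Theorems.SymPencilPerFourInnerRankReducedFamily
open Summit.ValiantsHypothesis.ValiantsHypothesis.Theorems.SymPencilPerFourPeeledFrame
open Summit.ValiantsHypothesis.ValiantsHypothesis.Theorems.SymPencilPerFourPeeledTwoPencilDesign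
open Summit.ValiantsHypothesis.ValiantsHypothesis.Theorems.SymPencilPerFourPeeledTenCaseA
open Summit.ValiantsHypothesis.ValiantsHypothesis.Theorems.SymPencilPerFourInnerRankPureGramKernel
open Summit.ValiantsHypothesis.ValiantsHypothesis.Theorems.SymPencilPerFourPeeledCornerSwap

universe u v

variable {K : Type u} [Field K]

/-- **The corner, given the relations — for any `a`-side correction vanishing on `e₂, e₃`.**
`…CornerSwap.false_of_swap_of_relations` verbatim, with its pure-swap hypothesis `hψ` weakened to
what the proof uses: `t(a,0)(e_y,0) = 0` for `y ∈ {2,3}` (so generalized swaps `u₀E₀₁ + w₀E₁₀`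
qualify). [folklore] -/
theorem false_of_relations_of_vanishing [CharZero K] {κ : Type v} [Fintype κ] [DecidableEq κ]
    (hκ : Fintype.card κ ≤ 11) (c : κ → K)
    (t : κ → (((Fin 4 → K) × (Fin 4 → K)) →ₗ[K] ((Fin 4 → K) × (Fin 4 → K)) →ₗ[K] K))
    (hJ : ∀ a b y₂ y₃ : Fin 4 → K,
      ∑ r, c r * (t r (a, b) (y₂, y₃)) ^ 2 = (Matrix.of ![a, b, y₂, y₃]).permanent)
    (v₀ v₀' : κ → K) (hv₀ : ∀ (a x : Fin 4 → K), ∃ s : K, (fun r => t r (a, 0) (x, 0)) = s • v₀)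
    (hv₀' : ∀ (b x : Fin 4 → K), ∃ s : K, (fun r => t r (0, b) (0, x)) = s • v₀')
    (hpeel : ∃ a b y z : Fin 4 → K, ∑ r, c r * t r (a, 0) (y, 0) * t r (0, b) (0, z) ≠ 0)
    (hψ23 : ∀ (a : Fin 4 → K) (y : Fin 4), (y = 2 ∨ y = 3) →
      ∀ r, t r (a, 0) (Pi.single y 1, 0) = 0)
    (R20 : ∀ r, t r (0, Pi.single 2 1) (Pi.single 0 1, 0) = t r (0, Pi.single 0 1) (Pi.single 2 1, 0))
    (R21 : ∀ r, t r (0, Pi.single 2 1) (Pi.single 1 1, 0) = t r (0, Pi.single 1 1) (Pi.single 2 1, 0))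
    (R31 : ∀ r, t r (0, Pi.single 3 1) (Pi.single 1 1, 0) = t r (0, Pi.single 1 1) (Pi.single 3 1, 0))
    (R32 : ∀ r, t r (0, Pi.single 3 1) (Pi.single 2 1, 0) = t r (0, Pi.single 2 1) (Pi.single 3 1, 0)) :
    False := by
  classical
  -- ===== Gram bookkeeping, verbatim after `…TwoPencilDesign.twelve_le_card_of_frame` =====
  have t00 : ∀ r (p : (Fin 4 → K) × (Fin 4 → K)), t r ((0 : Fin 4 → K), (0 : Fin 4 → K)) p = 0 :=
    fun r p => by rw [show ((0 : Fin 4 → K), (0 : Fin 4 → K)) = (0 : (Fin 4 → K) × (Fin 4 → K))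
      from rfl, map_zero, LinearMap.zero_apply]
  have t00' : ∀ r (p : (Fin 4 → K) × (Fin 4 → K)), t r p ((0 : Fin 4 → K), (0 : Fin 4 → K)) = 0 :=
    fun r p => by rw [show ((0 : Fin 4 → K), (0 : Fin 4 → K)) = (0 : (Fin 4 → K) × (Fin 4 → K))
      from rfl, map_zero]
  obtain ⟨a', b', yy, zz, hne⟩ := hpeel
  have hv0facts : (∑ r, c r * v₀ r ^ 2 = 0) ∧
      (∀ (a y : Fin 4 → K), ∑ r, c r * v₀ r * t r (a, 0) (0, y) = 0) ∧
      (∀ (b x : Fin 4 → K), ∑ r, c r * v₀ r * t r (0, b) (x, 0) = 0) := by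
    rcases scalar_block_dichotomy c t hJ v₀ hv₀ with hz | h
    · exact absurd (Finset.sum_eq_zero fun r _ => by rw [hz a' yy r]; ring) hne
    · exact h
  obtain ⟨hQv, hA₃, hB₂⟩ := hv0facts
  set tS : κ → (((Fin 4 → K) × (Fin 4 → K)) →ₗ[K] ((Fin 4 → K) × (Fin 4 → K)) →ₗ[K] K) :=
    fun r => ((t r).compl₁₂ (LinearEquiv.prodComm K (Fin 4 → K) (Fin 4 → K)).toLinearMap
      LinearMap.id).compl₂ (LinearEquiv.prodComm K (Fin 4 → K) (Fin 4 → K)).toLinearMap with htS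
  have hJS : ∀ a b y₂ y₃ : Fin 4 → K,
      ∑ r, c r * (tS r (a, b) (y₂, y₃)) ^ 2 = (Matrix.of ![a, b, y₂, y₃]).permanent :=
    hJ_yswap c _ (hJ_swap c t hJ)
  have htSap : ∀ r (a b y₂ y₃ : Fin 4 → K), tS r (a, b) (y₂, y₃) = t r (b, a) (y₃, y₂) :=
    fun r a b y₂ y₃ => by simp [htS]
  have hv0'facts : (∑ r, c r * v₀' r ^ 2 = 0) ∧
      (∀ (b y : Fin 4 → K), ∑ r, c r * v₀' r * t r (0, b) (y, 0) = 0) ∧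
      (∀ (a x : Fin 4 → K), ∑ r, c r * v₀' r * t r (a, 0) (0, x) = 0) := by
    rcases scalar_block_dichotomy c tS hJS v₀' (fun b x => by
        obtain ⟨s, hs⟩ := hv₀' b x
        exact ⟨s, by rw [← hs]; funext r; exact htSap r b 0 x 0⟩) with hz | ⟨h1, h2, h3⟩
    · refine absurd (Finset.sum_eq_zero fun r _ => ?_) hne
      have := hz b' zz r; rw [htSap] at this; rw [this]; ring
    · refine ⟨h1, fun b y => ?_, fun a x => ?_⟩
      · have := h2 b y; simpa only [htSap] using this
      · have := h3 a x; simpa only [htSap] using this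
  obtain ⟨hQv', hB₂', hA₃'⟩ := hv0'facts
  have hlam : ∑ r, c r * v₀ r * v₀' r ≠ 0 := by
    obtain ⟨s, hs⟩ := hv₀ a' yy
    obtain ⟨s', hs'⟩ := hv₀' b' zz
    have e1 : ∀ r, t r (a', 0) (yy, 0) = s * v₀ r := fun r => by
      have := congr_fun hs r; simpa using this
    have e2 : ∀ r, t r (0, b') (0, zz) = s' * v₀' r := fun r => by
      have := congr_fun hs' r; simpa using this
    intro h0
    apply hne
    have : ∑ r, c r * t r (a', 0) (yy, 0) * t r (0, b') (0, zz) =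
        s * s' * ∑ r, c r * v₀ r * v₀' r := by
      rw [Finset.mul_sum]; exact Finset.sum_congr rfl fun r _ => by rw [e1, e2]; ring
    rw [this, h0, mul_zero]
  let ν : (Fin 4 → K) →ₗ[K] (Fin 4 → K) →ₗ[K] (κ → K) :=
    LinearMap.mk₂ K (fun b y => fun r => t r (0, b) (y, 0))
      (fun b b' y => by
        funext r
        have : (((0 : Fin 4 → K), b + b') : (Fin 4 → K) × (Fin 4 → K)) = (0, b) + (0, b') := by simp
        simp only [Pi.add_apply, this, map_add, LinearMap.add_apply])
      (fun s b y => by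
        funext r
        have : (((0 : Fin 4 → K), s • b) : (Fin 4 → K) × (Fin 4 → K)) = s • (0, b) := by simp
        simp only [Pi.smul_apply, this, map_smul, LinearMap.smul_apply, smul_eq_mul])
      (fun b y y' => by
        funext r
        have : ((y + y', (0 : Fin 4 → K)) : (Fin 4 → K) × (Fin 4 → K)) = (y, 0) + (y', 0) := by simp
        simp only [Pi.add_apply, this, map_add])
      (fun s b y => by
        funext r
        have : ((s • y, (0 : Fin 4 → K)) : (Fin 4 → K) × (Fin 4 → K)) = s • (y, 0) := by simp
        simp only [Pi.smul_apply, this, map_smul, smul_eq_mul])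
  have hνap : ∀ b y r, ν b y r = t r (0, b) (y, 0) := fun b y r => rfl
  let μ : (Fin 4 → K) →ₗ[K] (Fin 4 → K) →ₗ[K] (κ → K) :=
    LinearMap.mk₂ K (fun a z => fun r => t r (a, 0) (0, z))
      (fun a a' z => by
        funext r
        have : ((a + a', (0 : Fin 4 → K)) : (Fin 4 → K) × (Fin 4 → K)) = (a, 0) + (a', 0) := by simp
        simp only [Pi.add_apply, this, map_add, LinearMap.add_apply])
      (fun s a z => by
        funext r
        have : ((s • a, (0 : Fin 4 → K)) : (Fin 4 → K) × (Fin 4 → K)) = s • (a, 0) := by simp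
        simp only [Pi.smul_apply, this, map_smul, LinearMap.smul_apply, smul_eq_mul])
      (fun a z z' => by
        funext r
        have : (((0 : Fin 4 → K), z + z') : (Fin 4 → K) × (Fin 4 → K)) = (0, z) + (0, z') := by simp
        simp only [Pi.add_apply, this, map_add])
      (fun s a z => by
        funext r
        have : (((0 : Fin 4 → K), s • z) : (Fin 4 → K) × (Fin 4 → K)) = s • (0, z) := by simp
        simp only [Pi.smul_apply, this, map_smul, smul_eq_mul])
  have hμap : ∀ a z r, μ a z r = t r (a, 0) (0, z) := fun a z r => rfl
  have hred := reduced_identity_of_scalar c t hJ v₀ v₀' hv₀ hv₀'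
  have hνiso : ∀ b y, ∑ r, c r * ν b y r * ν b y r = 0 := by
    intro b y
    have h := hred 0 b y 0
    simp only [t00, t00', add_zero, mul_zero, Finset.sum_const_zero, sub_zero,
      per_zero_row₀] at h
    rw [← h]
    exact Finset.sum_congr rfl fun r _ => by rw [hνap]; ring
  have hμiso : ∀ a z, ∑ r, c r * μ a z r * μ a z r = 0 := by
    intro a z
    have h := hred a 0 0 z
    simp only [t00, t00', zero_add, mul_zero, Finset.sum_const_zero, sub_zero,
      per_zero_row₂] at h
    rw [← h]
    exact Finset.sum_congr rfl fun r _ => by rw [hμap]; ring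
  have hX : ∀ a b y z, 2 * ∑ r, c r * ν b y r * μ a z r =
      (Matrix.of ![a, b, y, z]).permanent - 2 * ∑ r, c r * t r (a, 0) (y, 0) * t r (0, b) (0, z) := by
    intro a b y z
    have h := hred a b y z
    have e : ∑ r, c r * (t r (0, b) (y, 0) + t r (a, 0) (0, z)) ^ 2 =
        ∑ r, c r * ν b y r * ν b y r + ∑ r, c r * μ a z r * μ a z r +
          2 * ∑ r, c r * ν b y r * μ a z r := by
      rw [Finset.mul_sum, ← Finset.sum_add_distrib, ← Finset.sum_add_distrib]
      exact Finset.sum_congr rfl fun r _ => by rw [hνap, hμap]; ring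
    rw [e, hνiso, hμiso, zero_add, zero_add] at h
    exact h
  have hνν_b : ∀ b b' y, ∑ r, c r * ν b y r * ν b' y r = 0 := fun b b' y =>
    wdot_eq_zero_of_isotropic c _ _ (hνiso b y) (hνiso b' y)
      (by rw [← LinearMap.add_apply, ← map_add]; exact hνiso (b + b') y)
  have hνν_y : ∀ b y y', ∑ r, c r * ν b y r * ν b y' r = 0 := fun b y y' =>
    wdot_eq_zero_of_isotropic c _ _ (hνiso b y) (hνiso b y') (by rw [← map_add]; exact hνiso b (y + y'))
  have hν4 : ∀ b b' y y', ∑ r, c r * ν b y r * ν b' y' r + ∑ r, c r * ν b y' r * ν b' y r = 0 := by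
    intro b b' y y'
    have h := hνiso (b + b') (y + y')
    have hX : ν (b + b') (y + y') = ν b y + ν b y' + ν b' y + ν b' y' := by
      simp only [map_add, LinearMap.add_apply]; abel
    rw [hX, wdot_four, hνiso, hνiso, hνiso, hνiso, hνν_y b y y', hνν_b b b' y, hνν_b b b' y',
      hνν_y b' y y'] at h
    have h' : (2 : K) * (∑ r, c r * ν b y r * ν b' y' r + ∑ r, c r * ν b y' r * ν b' y r) = 0 := by
      linear_combination h
    exact (mul_eq_zero.1 h').resolve_left two_ne_zero
  -- ===== the corner (memo §3) =====
  -- cross pairings are pure permanents for y ∈ {2,3}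
  have hNM : ∀ (a b y z : Fin 4), (y = 2 ∨ y = 3) →
      ∑ r, c r * ν (Pi.single b 1) (Pi.single y 1) r * μ (Pi.single a 1) (Pi.single z 1) r =
        if (a ≠ b ∧ a ≠ y ∧ a ≠ z ∧ b ≠ y ∧ b ≠ z ∧ y ≠ z) then (1 / 2 : K) else 0 := by
    intro a b y z hy
    have h := hX (Pi.single a 1) (Pi.single b 1) (Pi.single y 1) (Pi.single z 1)
    rw [per_basis, show ∑ r, c r * t r (Pi.single a 1, 0) (Pi.single y 1, 0) *
        t r (0, Pi.single b 1) (0, Pi.single z 1) = 0 from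
      Finset.sum_eq_zero fun r _ => by rw [hψ23 _ y hy r]; ring] at h
    split_ifs at h ⊢ <;> linear_combination h / 2
  have hMN : ∀ (a b y z : Fin 4), (y = 2 ∨ y = 3) →
      ∑ r, c r * μ (Pi.single a 1) (Pi.single z 1) r * ν (Pi.single b 1) (Pi.single y 1) r =
        if (a ≠ b ∧ a ≠ y ∧ a ≠ z ∧ b ≠ y ∧ b ≠ z ∧ y ≠ z) then (1 / 2 : K) else 0 :=
    fun a b y z hy => by rw [wdot_comm, hNM a b y z hy]
  have R20' : ν (Pi.single 2 1 : Fin 4 → K) (Pi.single 0 1 : Fin 4 → K) = ν (Pi.single 0 1 : Fin 4 → K) (Pi.single 2 1 : Fin 4 → K) := funext fun r => by rw [hνap, hνap]; exact R20 r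
  have R21' : ν (Pi.single 2 1 : Fin 4 → K) (Pi.single 1 1 : Fin 4 → K) = ν (Pi.single 1 1 : Fin 4 → K) (Pi.single 2 1 : Fin 4 → K) := funext fun r => by rw [hνap, hνap]; exact R21 r
  have R31' : ν (Pi.single 3 1 : Fin 4 → K) (Pi.single 1 1 : Fin 4 → K) = ν (Pi.single 1 1 : Fin 4 → K) (Pi.single 3 1 : Fin 4 → K) := funext fun r => by rw [hνap, hνap]; exact R31 r
  have R32' : ν (Pi.single 3 1 : Fin 4 → K) (Pi.single 2 1 : Fin 4 → K) = ν (Pi.single 2 1 : Fin 4 → K) (Pi.single 3 1 : Fin 4 → K) := funext fun r => by rw [hνap, hνap]; exact R32 r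
  -- β = ⟨ν₀₂, ν₁₃⟩ = 0
  have hβ : ∑ r, c r * ν (Pi.single 0 1 : Fin 4 → K) (Pi.single 2 1 : Fin 4 → K) r * ν (Pi.single 1 1 : Fin 4 → K) (Pi.single 3 1 : Fin 4 → K) r = 0 := by
    have s1 : ∑ r, c r * ν (Pi.single 0 1 : Fin 4 → K) (Pi.single 1 1 : Fin 4 → K) r * ν (Pi.single 2 1 : Fin 4 → K) (Pi.single 3 1 : Fin 4 → K) r = ∑ r, c r * ν (Pi.single 0 1 : Fin 4 → K) (Pi.single 1 1 : Fin 4 → K) r * ν (Pi.single 3 1 : Fin 4 → K) (Pi.single 2 1 : Fin 4 → K) r := by rw [R32']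
    have a1 := hν4 (Pi.single 0 1 : Fin 4 → K) (Pi.single 2 1 : Fin 4 → K) (Pi.single 1 1 : Fin 4 → K) (Pi.single 3 1 : Fin 4 → K)
    have a2 := hν4 (Pi.single 0 1 : Fin 4 → K) (Pi.single 1 1 : Fin 4 → K) (Pi.single 3 1 : Fin 4 → K) (Pi.single 2 1 : Fin 4 → K)
    have a3 := hν4 (Pi.single 0 1 : Fin 4 → K) (Pi.single 3 1 : Fin 4 → K) (Pi.single 1 1 : Fin 4 → K) (Pi.single 2 1 : Fin 4 → K)
    rw [R21'] at a1
    rw [R31'] at a3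
    have h2 : (2 : K) * ∑ r, c r * ν (Pi.single 0 1 : Fin 4 → K) (Pi.single 2 1 : Fin 4 → K) r * ν (Pi.single 1 1 : Fin 4 → K) (Pi.single 3 1 : Fin 4 → K) r = 0 := by linear_combination a2 - a1 + a3 + s1
    exact (mul_eq_zero.1 h2).resolve_left two_ne_zero
  have z_02_02 : ∑ r, c r * ν (Pi.single 0 1 : Fin 4 → K) (Pi.single 2 1 : Fin 4 → K) r * ν (Pi.single 0 1 : Fin 4 → K) (Pi.single 2 1 : Fin 4 → K) r = 0 := hνiso _ _
  have z_02_12 : ∑ r, c r * ν (Pi.single 0 1 : Fin 4 → K) (Pi.single 2 1 : Fin 4 → K) r * ν (Pi.single 1 1 : Fin 4 → K) (Pi.single 2 1 : Fin 4 → K) r = 0 := hνν_b _ _ _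
  have z_02_03 : ∑ r, c r * ν (Pi.single 0 1 : Fin 4 → K) (Pi.single 2 1 : Fin 4 → K) r * ν (Pi.single 0 1 : Fin 4 → K) (Pi.single 3 1 : Fin 4 → K) r = 0 := hνν_y _ _ _
  have z_02_13 : ∑ r, c r * ν (Pi.single 0 1 : Fin 4 → K) (Pi.single 2 1 : Fin 4 → K) r * ν (Pi.single 1 1 : Fin 4 → K) (Pi.single 3 1 : Fin 4 → K) r = 0 := hβ
  have z_02_23 : ∑ r, c r * ν (Pi.single 0 1 : Fin 4 → K) (Pi.single 2 1 : Fin 4 → K) r * ν (Pi.single 2 1 : Fin 4 → K) (Pi.single 3 1 : Fin 4 → K) r = 0 := by rw [← R20']; exact hνν_y _ _ _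
  have z_12_02 : ∑ r, c r * ν (Pi.single 1 1 : Fin 4 → K) (Pi.single 2 1 : Fin 4 → K) r * ν (Pi.single 0 1 : Fin 4 → K) (Pi.single 2 1 : Fin 4 → K) r = 0 := by rw [wdot_comm]; exact z_02_12
  have z_12_12 : ∑ r, c r * ν (Pi.single 1 1 : Fin 4 → K) (Pi.single 2 1 : Fin 4 → K) r * ν (Pi.single 1 1 : Fin 4 → K) (Pi.single 2 1 : Fin 4 → K) r = 0 := hνiso _ _
  have z_12_03 : ∑ r, c r * ν (Pi.single 1 1 : Fin 4 → K) (Pi.single 2 1 : Fin 4 → K) r * ν (Pi.single 0 1 : Fin 4 → K) (Pi.single 3 1 : Fin 4 → K) r = 0 := by have a2 := hν4 (Pi.single 0 1 : Fin 4 → K) (Pi.single 1 1 : Fin 4 → K) (Pi.single 3 1 : Fin 4 → K) (Pi.single 2 1 : Fin 4 → K); rw [hβ, add_zero] at a2; rw [wdot_comm]; exact a2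
  have z_12_13 : ∑ r, c r * ν (Pi.single 1 1 : Fin 4 → K) (Pi.single 2 1 : Fin 4 → K) r * ν (Pi.single 1 1 : Fin 4 → K) (Pi.single 3 1 : Fin 4 → K) r = 0 := hνν_y _ _ _
  have z_12_23 : ∑ r, c r * ν (Pi.single 1 1 : Fin 4 → K) (Pi.single 2 1 : Fin 4 → K) r * ν (Pi.single 2 1 : Fin 4 → K) (Pi.single 3 1 : Fin 4 → K) r = 0 := by rw [← R21']; exact hνν_y _ _ _
  have z_03_02 : ∑ r, c r * ν (Pi.single 0 1 : Fin 4 → K) (Pi.single 3 1 : Fin 4 → K) r * ν (Pi.single 0 1 : Fin 4 → K) (Pi.single 2 1 : Fin 4 → K) r = 0 := by rw [wdot_comm]; exact z_02_03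
  have z_03_12 : ∑ r, c r * ν (Pi.single 0 1 : Fin 4 → K) (Pi.single 3 1 : Fin 4 → K) r * ν (Pi.single 1 1 : Fin 4 → K) (Pi.single 2 1 : Fin 4 → K) r = 0 := by rw [wdot_comm]; exact z_12_03
  have z_03_03 : ∑ r, c r * ν (Pi.single 0 1 : Fin 4 → K) (Pi.single 3 1 : Fin 4 → K) r * ν (Pi.single 0 1 : Fin 4 → K) (Pi.single 3 1 : Fin 4 → K) r = 0 := hνiso _ _
  have z_03_13 : ∑ r, c r * ν (Pi.single 0 1 : Fin 4 → K) (Pi.single 3 1 : Fin 4 → K) r * ν (Pi.single 1 1 : Fin 4 → K) (Pi.single 3 1 : Fin 4 → K) r = 0 := hνν_b _ _ _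
  have z_03_23 : ∑ r, c r * ν (Pi.single 0 1 : Fin 4 → K) (Pi.single 3 1 : Fin 4 → K) r * ν (Pi.single 2 1 : Fin 4 → K) (Pi.single 3 1 : Fin 4 → K) r = 0 := hνν_b _ _ _
  have z_13_02 : ∑ r, c r * ν (Pi.single 1 1 : Fin 4 → K) (Pi.single 3 1 : Fin 4 → K) r * ν (Pi.single 0 1 : Fin 4 → K) (Pi.single 2 1 : Fin 4 → K) r = 0 := by rw [wdot_comm]; exact z_02_13
  have z_13_12 : ∑ r, c r * ν (Pi.single 1 1 : Fin 4 → K) (Pi.single 3 1 : Fin 4 → K) r * ν (Pi.single 1 1 : Fin 4 → K) (Pi.single 2 1 : Fin 4 → K) r = 0 := by rw [wdot_comm]; exact z_12_13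
  have z_13_03 : ∑ r, c r * ν (Pi.single 1 1 : Fin 4 → K) (Pi.single 3 1 : Fin 4 → K) r * ν (Pi.single 0 1 : Fin 4 → K) (Pi.single 3 1 : Fin 4 → K) r = 0 := by rw [wdot_comm]; exact z_03_13
  have z_13_13 : ∑ r, c r * ν (Pi.single 1 1 : Fin 4 → K) (Pi.single 3 1 : Fin 4 → K) r * ν (Pi.single 1 1 : Fin 4 → K) (Pi.single 3 1 : Fin 4 → K) r = 0 := hνiso _ _
  have z_13_23 : ∑ r, c r * ν (Pi.single 1 1 : Fin 4 → K) (Pi.single 3 1 : Fin 4 → K) r * ν (Pi.single 2 1 : Fin 4 → K) (Pi.single 3 1 : Fin 4 → K) r = 0 := hνν_b _ _ _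
  have z_23_02 : ∑ r, c r * ν (Pi.single 2 1 : Fin 4 → K) (Pi.single 3 1 : Fin 4 → K) r * ν (Pi.single 0 1 : Fin 4 → K) (Pi.single 2 1 : Fin 4 → K) r = 0 := by rw [wdot_comm]; exact z_02_23
  have z_23_12 : ∑ r, c r * ν (Pi.single 2 1 : Fin 4 → K) (Pi.single 3 1 : Fin 4 → K) r * ν (Pi.single 1 1 : Fin 4 → K) (Pi.single 2 1 : Fin 4 → K) r = 0 := by rw [wdot_comm]; exact z_12_23
  have z_23_03 : ∑ r, c r * ν (Pi.single 2 1 : Fin 4 → K) (Pi.single 3 1 : Fin 4 → K) r * ν (Pi.single 0 1 : Fin 4 → K) (Pi.single 3 1 : Fin 4 → K) r = 0 := by rw [wdot_comm]; exact z_03_23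
  have z_23_13 : ∑ r, c r * ν (Pi.single 2 1 : Fin 4 → K) (Pi.single 3 1 : Fin 4 → K) r * ν (Pi.single 1 1 : Fin 4 → K) (Pi.single 3 1 : Fin 4 → K) r = 0 := by rw [wdot_comm]; exact z_13_23
  have z_23_23 : ∑ r, c r * ν (Pi.single 2 1 : Fin 4 → K) (Pi.single 3 1 : Fin 4 → K) r * ν (Pi.single 2 1 : Fin 4 → K) (Pi.single 3 1 : Fin 4 → K) r = 0 := hνiso _ _
  -- package and apply the twelve-vector lemma
  refine false_of_twelve_vectors hκ c (fun b y => ν (Pi.single b 1) (Pi.single y 1))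
    (fun a z => μ (Pi.single a 1) (Pi.single z 1)) v₀ v₀' ?_ hNM (fun b y => hB₂ _ _)
    (fun a z => hA₃ _ _) (fun b y => hB₂' _ _)
    (by rw [← hQv]; exact Finset.sum_congr rfl fun r _ => by ring) hlam
  intro p q
  fin_cases p <;> fin_cases q
  · exact z_02_02
  · exact z_02_12
  · exact z_02_03
  · exact z_02_13
  · exact z_02_23
  · exact z_12_02
  · exact z_12_12
  · exact z_12_03
  · exact z_12_13
  · exact z_12_23
  · exact z_03_02
  · exact z_03_12
  · exact z_03_03
  · exact z_03_13
  · exact z_03_23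
  · exact z_13_02
  · exact z_13_12
  · exact z_13_03
  · exact z_13_13
  · exact z_13_23
  · exact z_23_02
  · exact z_23_12
  · exact z_23_03
  · exact z_23_13
  · exact z_23_23

end Summit.ValiantsHypothesis.ValiantsHypothesis.Theorems.SymPencilPerFourPeeledCornerGenSwapRelations

end
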